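import Summits.Ventures.PercRepro.ThetaOmegaTwoBad
import Summits.Ventures.PercRepro.ThetaOmegaAntiSame

/-!
# The core of (Ω): the all-exceptional families

Dossier proofs/MINE1-theoremS.md, Addendum 81 (mine-1, gen 42). The good-point property
`OmegaGoodPoint` of `ThetaOmegaSplit.lean` asks, at a point `q` with at least three edges, for a
credit `≥ |K_q|` directly — which (by the exact credit lemma) is (Ω) for the edge family `K_q` on
`U \ q`, i.e. the statement being proved. Inside the ground-set induction that bound is available
by the induction hypothesis, so the only points that can fail are those whose edge family is
**exceptional**: `|K_q| ∈ {1, 2}` and `Ω(K_q) < |K_q|` (`ExcEdges`). This file proves that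
reduction:

* `omegaCredit` — the credit at a point, `e_q(A) + e_q(C)`;
* `ExcEdges` — the edge family at `q` is exceptional;
* `OmegaCore` — **the core statement**: on a ground set with at least three points, a family with
  at least three members all of whose points have exceptional edge families has a point whose
  credit is at least the number of its edges;
* `canonOrient`, `validOrient_canon` — the orientation choosing the `q`-free member;
* `three_le_card_projFam` — if every point of a ground set with at least three points carries an
  edge, every projection keeps at least three members (two edge directions only fit in a family
  of the shape `{s, s + q, t, t + q}`);
* `conjOmega_of_core` — **(Ω) follows from the core statement**: in the induction a point
  without edges, a point with at least three edges (induction hypothesis for the edge family) and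
  a point with a non-exceptional edge family are all good, so the core statement is all that is
  left; `conjSigma_of_core`.

The second disjunct of the good-point property (projections with at most two members) is never
needed: a point whose projection has at most two members forces two edge directions only, so some
other point has no edge and is good by itself.
-/

namespace PercRepro.MSTight

open Finset

variable {α : Type*} [DecidableEq α]

section CoreDefs

variable {U : Finset α} {F : Finset (Finset α)} {c0 c1 : Finset α → Bool} {q : α}

/-- **The credit at a point**: the number of `q`-edges of the `A`-family plus the number of
`q`-edges of the `C`-family. -/
def omegaCredit (U : Finset α) (F : Finset (Finset α)) (c0 c1 : Finset α → Bool) (q : α) : ℕ :=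
  (qEdges q (omegaA F c0 c1)).card + (qEdges q (omegaC U F c1)).card

/-- **An exceptional edge family**: one or two edges whose (Ω)-count (coloured by `c0 ∘ insert q`
and `c1`, on `U \ q`) falls short of the number of edges. -/
def ExcEdges (U : Finset α) (F : Finset (Finset α)) (c0 c1 : Finset α → Bool) (q : α) : Prop :=
  1 ≤ (qEdges q F).card ∧ (qEdges q F).card ≤ 2 ∧
    omegaCount (U.erase q) (qEdges q F) (edgeC0 q c0) c1 < (qEdges q F).card

/-- **The core statement**: on a ground set with at least three points, every family with at least
three members all of whose points have exceptional edge families has a point whose credit pays its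
edges. -/
def OmegaCore (α : Type*) [DecidableEq α] : Prop :=
  ∀ (U : Finset α) (F : Finset (Finset α)) (c0 c1 : Finset α → Bool),
    (∀ s ∈ F, s ⊆ U) → 3 ≤ F.card → 3 ≤ U.card →
      (∀ q ∈ U, ExcEdges U F c0 c1 q) →
        ∃ q ∈ U, (qEdges q F).card ≤ omegaCredit U F c0 c1 q

/-- The credit unfolded. -/
theorem omegaCredit_def :
    omegaCredit U F c0 c1 q =
      (qEdges q (omegaA F c0 c1)).card + (qEdges q (omegaC U F c1)).card := rfl

/-- The exact credit lemma in terms of the credit. -/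
theorem omegaCount_qEdges_le_omegaCredit (hq : q ∈ U) :
    omegaCount (U.erase q) (qEdges q F) (edgeC0 q c0) c1 ≤ omegaCredit U F c0 c1 q :=
  omegaCount_qEdges_le_credit hq

end CoreDefs

section Orientation

variable {U : Finset α} {F : Finset (Finset α)} {q : α}

/-- **The canonical orientation**: a projected set takes the colours of its `q`-free member when
that is a member, and of its `q`-member otherwise. -/
def canonOrient (F : Finset (Finset α)) : Finset α → Bool := fun s => decide (s ∉ F)

/-- The canonical orientation is valid at every point. -/
theorem validOrient_canon (q : α) (F : Finset (Finset α)) : ValidOrient q F (canonOrient F) := by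
  intro s hs
  obtain ⟨x, hx, rfl⟩ := mem_projFam.1 hs
  constructor
  · intro h
    have hnot : x.erase q ∉ F := by simpa [canonOrient] using h
    have hqx : q ∈ x := by
      by_contra hqx
      rw [erase_eq_of_notMem hqx] at hnot
      exact hnot hx
    rwa [insert_erase hqx]
  · intro h
    simpa [canonOrient] using h

/-- The members of the projection are subsets of `U \ q`. -/
theorem projFam_subset_erase (hF : ∀ s ∈ F, s ⊆ U) :
    ∀ s ∈ projFam q F, s ⊆ U.erase q := by
  intro s hs
  obtain ⟨x, hx, rfl⟩ := mem_projFam.1 hs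
  intro a ha
  rw [mem_erase] at ha ⊢
  exact ⟨ha.1, hF x hx ha.2⟩

/-- The edges at `q` are subsets of `U \ q`. -/
theorem qEdges_subset_erase (hF : ∀ s ∈ F, s ⊆ U) :
    ∀ s ∈ qEdges q F, s ⊆ U.erase q := by
  intro s hs
  obtain ⟨hsF, hqs, -⟩ := mem_qEdges.1 hs
  intro a ha
  rw [mem_erase]
  exact ⟨fun h => hqs (h ▸ ha), hF s hsF ha⟩

/-- The split of `F` at `q`, with the projection named. -/
theorem card_eq_card_projFam_add_card_qEdges (q : α) (F : Finset (Finset α)) :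
    F.card = (projFam q F).card + (qEdges q F).card :=
  card_eq_card_image_erase_add_card_qEdges q F

/-- A point without edges keeps every member in the projection. -/
theorem card_projFam_of_qEdges_eq_empty (h : qEdges q F = ∅) : (projFam q F).card = F.card := by
  have := card_eq_card_projFam_add_card_qEdges q F
  rw [h, card_empty] at this
  omega

end Orientation

section TwoDirections

variable {U : Finset α} {F : Finset (Finset α)} {q : α}

/-- An edge at `r ≠ q` gives two members of the projection at `q` differing exactly in `r`. -/
theorem exists_mem_projFam_of_qEdges_nonempty {r : α} (hrq : r ≠ q)
    (h : (qEdges r F).Nonempty) :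
    ∃ e ∈ projFam q F, r ∉ e ∧ insert r e ∈ projFam q F := by
  obtain ⟨d, hd⟩ := h
  obtain ⟨hdF, hrd, hrdF⟩ := mem_qEdges.1 hd
  refine ⟨d.erase q, mem_projFam.2 ⟨d, hdF, rfl⟩, fun h => hrd (mem_of_mem_erase h), ?_⟩
  refine mem_projFam.2 ⟨insert r d, hrdF, ?_⟩
  rw [erase_insert_of_ne hrq]

/-- A projection with at most two members containing `e` and `e + r` is `{e, e + r}`. -/
theorem projFam_eq_pair_of_card_le_two {P : Finset (Finset α)} {e : Finset α} {r : α}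
    (hP : P.card ≤ 2) (he : e ∈ P) (hre : r ∉ e) (her : insert r e ∈ P) :
    P = {e, insert r e} := by
  have hne : e ≠ insert r e := by
    intro h
    exact hre (h ▸ mem_insert_self r e)
  have hsub : ({e, insert r e} : Finset (Finset α)) ⊆ P := by
    intro z hz
    rcases mem_insert.1 hz with rfl | hz
    · exact he
    · rw [mem_singleton.1 hz]; exact her
  have hcard : P.card ≤ ({e, insert r e} : Finset (Finset α)).card := by
    rw [card_pair hne]; exact hP
  exact (eq_of_subset_of_card_le hsub hcard).symm

/-- **Two edge directions only fit in a projection with at most two members**: if the projection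
at `q` has at most two members, two distinct points `r ≠ r'` other than `q` cannot both carry an
edge. -/
theorem not_two_edges_of_card_projFam_le_two {r r' : α} (hP : (projFam q F).card ≤ 2)
    (hrq : r ≠ q) (hr'q : r' ≠ q) (hrr' : r ≠ r') (hr : (qEdges r F).Nonempty)
    (hr' : (qEdges r' F).Nonempty) : False := by
  obtain ⟨e, he, hre, her⟩ := exists_mem_projFam_of_qEdges_nonempty hrq hr
  obtain ⟨e', he', hre', her'⟩ := exists_mem_projFam_of_qEdges_nonempty hr'q hr'
  have hPeq := projFam_eq_pair_of_card_le_two hP he hre her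
  rw [hPeq] at he' her'
  -- the cards of the members of the projection are `|e|` and `|e| + 1`
  have hce : (insert r e).card = e.card + 1 := card_insert_of_notMem hre
  have hce' : (insert r' e').card = e'.card + 1 := card_insert_of_notMem hre'
  rcases mem_insert.1 he' with he'e | he'
  · -- `e' = e`: then `e + r' ∈ {e, e + r}` forces `r' = r`
    rw [he'e] at her' hre'
    rcases mem_insert.1 her' with h | h
    · have := congrArg Finset.card h
      rw [card_insert_of_notMem hre'] at this
      omega
    · rw [mem_singleton] at h
      have hr'mem : r' ∈ insert r e := h ▸ mem_insert_self r' e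
      rcases mem_insert.1 hr'mem with h' | h'
      · exact hrr' h'.symm
      · exact hre' h'
  · -- `e' = e + r`: then `e' + r'` has `|e| + 2` elements, too many
    rw [mem_singleton] at he'
    rw [he'] at her' hre' hce'
    rcases mem_insert.1 her' with h | h
    · have := congrArg Finset.card h
      omega
    · rw [mem_singleton] at h
      have := congrArg Finset.card h
      omega

/-- **Every projection keeps at least three members** when the ground set has at least three
points and every point carries an edge. -/
theorem three_le_card_projFam (hU : 3 ≤ U.card) (hall : ∀ r ∈ U, (qEdges r F).Nonempty)
    (hq : q ∈ U) : 3 ≤ (projFam q F).card := by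
  by_contra h
  have hP : (projFam q F).card ≤ 2 := by omega
  -- two points other than `q`
  have h2 : 1 < (U.erase q).card := by
    rw [card_erase_of_mem hq]; omega
  obtain ⟨r, hr, r', hr', hrr'⟩ := one_lt_card.1 h2
  rw [mem_erase] at hr hr'
  exact not_two_edges_of_card_projFam_le_two hP hr.1 hr'.1 hrr' (hall r hr.2) (hall r' hr'.2)

end TwoDirections

section Main

/-- **(Ω) follows from the core statement**, by strong induction on the ground set: at a point
without edges, at a point with at least three edges (the induction hypothesis for its edge family
pays the credit through the exact credit lemma) and at a point with a non-exceptional edge family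
the step goes through directly; when every point has an exceptional edge family the core statement
names the point. -/
theorem conjOmega_of_core (hcore : OmegaCore α) : ConjOmega α := by
  intro U
  induction U using Finset.strongInduction with
  | H U ih =>
    intro F c0 c1 hF h3
    by_cases hU : U.card ≤ 2
    · exact omegaBase U F c0 c1 hU hF h3
    have hU3 : 3 ≤ U.card := by omega
    -- the step at a point whose projection keeps three members and whose credit pays its edges
    have hgood : ∀ q ∈ U, 3 ≤ (projFam q F).card →
        (qEdges q F).card ≤ omegaCredit U F c0 c1 q → F.card ≤ omegaCount U F c0 c1 := by
      intro q hq hP3 hcred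
      have hih := ih (U.erase q) (erase_ssubset hq) (projFam q F)
        (projColour q (canonOrient F) c0) (projColour q (canonOrient F) c1)
        (projFam_subset_erase hF) hP3
      exact card_le_omegaCount_of_step' (validOrient_canon q F) hih hcred
    -- a point without edges is good by itself
    by_cases hemp : ∃ q ∈ U, qEdges q F = ∅
    · obtain ⟨q, hq, hK⟩ := hemp
      refine hgood q hq ?_ ?_
      · rw [card_projFam_of_qEdges_eq_empty hK]; exact h3
      · rw [hK, card_empty]; exact Nat.zero_le _
    have hall : ∀ r ∈ U, (qEdges r F).Nonempty :=
      fun r hr => nonempty_iff_ne_empty.2 (fun h => hemp ⟨r, hr, h⟩)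
    have hP3 : ∀ q ∈ U, 3 ≤ (projFam q F).card :=
      fun q hq => three_le_card_projFam hU3 hall hq
    -- a point with at least three edges: the induction hypothesis for its edge family
    by_cases hbig : ∃ q ∈ U, 3 ≤ (qEdges q F).card
    · obtain ⟨q, hq, hK3⟩ := hbig
      refine hgood q hq (hP3 q hq) ?_
      have hih := ih (U.erase q) (erase_ssubset hq) (qEdges q F) (edgeC0 q c0) c1
        (qEdges_subset_erase hF) hK3
      exact le_trans hih (omegaCount_qEdges_le_omegaCredit hq)
    have hsmall : ∀ q ∈ U, (qEdges q F).card ≤ 2 := fun q hq => by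
      by_contra h
      exact hbig ⟨q, hq, by omega⟩
    -- a point with a non-exceptional edge family
    by_cases hnexc : ∃ q ∈ U,
        (qEdges q F).card ≤ omegaCount (U.erase q) (qEdges q F) (edgeC0 q c0) c1
    · obtain ⟨q, hq, hle⟩ := hnexc
      exact hgood q hq (hP3 q hq) (le_trans hle (omegaCount_qEdges_le_omegaCredit hq))
    have hlt : ∀ q ∈ U, omegaCount (U.erase q) (qEdges q F) (edgeC0 q c0) c1 < (qEdges q F).card :=
      fun q hq => by
        by_contra h
        exact hnexc ⟨q, hq, by omega⟩
    -- every point has an exceptional edge family: the core statement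
    have hexc : ∀ q ∈ U, ExcEdges U F c0 c1 q := fun q hq =>
      ⟨card_pos.2 (hall q hq), hsmall q hq, hlt q hq⟩
    obtain ⟨q, hq, hcred⟩ := hcore U F c0 c1 hF h3 hU3 hexc
    exact hgood q hq (hP3 q hq) hcred

/-- **(Σ) follows from the core statement.** -/
theorem conjSigma_of_core [Fintype α] (hcore : OmegaCore α) : ConjSigma α :=
  conjSigma_of_conjOmega (conjOmega_of_core hcore)

end Main

end PercRepro.MSTight
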